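import Mathlib
import HarnessLib
import Literature.MathematicalPhysics.QuantumManyBody.BoseGasThermodynamicLimitRuelle
import Literature.MathematicalPhysics.QuantumManyBody.BoseGasStructureFactor
import Literature.MathematicalPhysics.QuantumManyBody.PeriodicBoseGasThm31
import Literature.MathematicalPhysics.QuantumManyBody.LiebYngvasonPoincare
import Literature.MathematicalPhysics.QuantumManyBody.LiebYngvasonLowerBound
import Literature.MathematicalPhysics.QuantumManyBody.PeriodicConfigFourier
import Literature.MathematicalPhysics.QuantumManyBody.PeriodicBoseGasUpperBoundProofs

set_option autoImplicit false

/-!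
# BlockLatticeFSum · residual `DeepInfraredEmptiness` (stmt-AtomisticToContinuum-27506) — THE FREE LEAF `FreeDensityFlatness` IS PROVED
# (decomp-a2c lens-6 «barrier-complement carving», generation 24, §9 of the node file `HyperuniformCarving.lean` (sha256 9fc319fe…);
# def-free tree twin landed by prover hand 1 (g7) at the critic's licence row 350 (3); source = lens-6 g24 `scratch/FreeFlatnessStandalone.lean`
# (sha256 cb87982b…) with the scratch `def`s `FreeDensityFlatness` / `phaseArg` INLINED — statement text and proofs otherwise verbatim)

The line of record beneath `DeepInfraredEmptiness` is `DeepPointwiseOne ⟸ DeepDensityFlatness (A) ∧ LinearResponseGain (B)` (lens-6 g23).  Piece A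
splits by the scattering length: `a > 0` is a by-name consequence of the SHARED open crux `TorusHyperuniformity` (stmt-AtomisticToContinuum-9093;
companion file `DeepInfraredEmptinessHyperuniformCarving`), and `a = 0` — the FREE LEAF — is proved here outright:

`freeDensityFlatness_holds` — for a repulsive finite-range `v` with `scatteringLength v = 0`, with `κ = 1`, `σ = 9`, `ρ₀ = 1` and
`δ_N = π²/(L_N² N²)`: every `δ_N`-near-minimiser `Ψ` of the periodic `N`-body problem in the box of side `L_N = sideLength ρ N` has
`structureFactorVar N L_N (1_cell·Ψ) m ≤ 9·N` for EVERY lattice momentum `m ≠ 0` (the wavevector window is not even used).  Proof: `E₀^per = 0`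
(LSSY upper bound at `a = 0`), the Neumann Poincaré gap of the cube (`poincare_boxN`) gives `‖Ψ − c̄‖²_{L²(cell)} ≤ N⁻²`, Minkowski, the Literature
Lipschitz lemma `lintegral_densityWave_sub_sq_rpow_le` (`√(N S)` is `N`-Lipschitz in the state), and the UNIFORM SECOND MOMENT of the density wave
`lintegral_cellN_nnnorm_densityWave_sq : ∫_{cell^N} |ρ̂_m|² = N·|cell^N|` (`m ≠ 0`), itself from `|ρ̂_m|² = Σ_{j,l} cos(θ_j − θ_l)` and the
orthogonality `∫_{cell^N} cos(θ_j − θ_l) = 0` (`j ≠ l`; `Re ∫ e_n` with `n = m ⊗ (δ_j − δ_l) ≠ 0`, via `cellWaveN` / `integral_fromUnitTorusN` /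
`orthonormal_mFourier`).  Imports Literature only; no definitions; 0 sorry.  `[cite: LSSY2005, Thm. 2.2 and after (2.50)]` for the free upper bound,
everything else `[folklore]`.
-/

namespace Summit.AtomisticToContinuum.BoseEinsteinCondensation.Theorems.DeepInfraredEmptinessFreeFlatness

open Filter MeasureTheory UnitAddTorus
open scoped ENNReal
open Literature.MathematicalPhysics.QuantumManyBody.BoseGas


section FreeGas

variable {N : ℕ}

/-- The phase `θ_j(X) = (2π/L) m·x_j` of particle `j` in the density wave `ρ̂_m` is continuous in the configuration. [folklore] -/
theorem continuous_phaseArg (L : ℝ) (m : Fin 3 → ℤ) (j : Fin N) :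
    Continuous fun X : Config N => (2 * Real.pi / L * ∑ t, (m t : ℝ) * X j t) := by
  refine continuous_const.mul (continuous_finsetSum _ fun t _ => continuous_const.mul ?_)
  exact (PiLp.continuous_apply 2 (fun _ : Fin 3 => ℝ) t).comp (continuous_apply j)

/-- `|ρ̂_m(X)|² = Σ_{j,l} cos(θ_j − θ_l)`. [folklore] -/
theorem norm_densityWave_sq_eq_sum_cos (L : ℝ) (m : Fin 3 → ℤ) (X : Config N) :
    ‖densityWave N L m X‖ ^ 2 = ∑ j : Fin N, ∑ l : Fin N, Real.cos ((2 * Real.pi / L * ∑ t, (m t : ℝ) * X j t) - (2 * Real.pi / L * ∑ t, (m t : ℝ) * X l t)) := by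
  have hre : ∀ θ : ℝ, (Complex.exp (Complex.I * θ)).re = Real.cos θ := fun θ => by
    rw [mul_comm, Complex.exp_ofReal_mul_I_re]
  have him : ∀ θ : ℝ, (Complex.exp (Complex.I * θ)).im = Real.sin θ := fun θ => by
    rw [mul_comm, Complex.exp_ofReal_mul_I_im]
  rw [densityWave, Complex.sq_norm, Complex.normSq_apply, Complex.re_sum, Complex.im_sum]
  simp only [hre, him]
  rw [Finset.sum_mul_sum, Finset.sum_mul_sum, ← Finset.sum_add_distrib]
  refine Finset.sum_congr rfl fun j _ => ?_
  rw [← Finset.sum_add_distrib]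
  refine Finset.sum_congr rfl fun l _ => ?_
  rw [Real.cos_sub]

/-- Orthogonality of distinct particles' phases on the torus cell: for `m ≠ 0` and `j ≠ l`,
`∫_{cell^N} cos(θ_j − θ_l) dX = 0` (the integrand is `Re e_n` for the non-zero frequency
`n = m ⊗ (δ_j − δ_l) ∈ ℤ^{3N}`). [folklore] -/
theorem integral_cellN_cos_phaseArg_sub {L : ℝ} (hL : 0 < L) {m : Fin 3 → ℤ} (hm : m ≠ 0)
    {j l : Fin N} (hjl : j ≠ l) :
    ∫ X in cellN N L, Real.cos ((2 * Real.pi / L * ∑ t, (m t : ℝ) * X j t) - (2 * Real.pi / L * ∑ t, (m t : ℝ) * X l t)) = 0 := by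
  classical
  let n : Fin N × Fin 3 → ℤ := fun p => (if p.1 = j then m p.2 else 0) - (if p.1 = l then m p.2 else 0)
  have hn0 : n ≠ 0 := by
    obtain ⟨t, ht⟩ := Function.ne_iff.1 hm
    intro h
    have h1 := congr_fun h (j, t)
    simp only [n, if_neg hjl, sub_zero, Pi.zero_apply] at h1
    exact ht h1
  have hrow : ∀ (i : Fin N) (X : Config N),
      (∑ p : Fin N × Fin 3, ((if p.1 = i then m p.2 else 0 : ℤ) : ℝ) * X p.1 p.2) =
        ∑ t, (m t : ℝ) * X i t := by
    intro i X
    rw [Fintype.sum_prod_type, Finset.sum_eq_single i]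
    · simp only [if_true]
    · intro b _ hb
      simp [hb]
    · intro h; exact absurd (Finset.mem_univ i) h
  have hphase : ∀ X : Config N, (∑ p : Fin N × Fin 3, (n p : ℝ) * X p.1 p.2) =
      (∑ t, (m t : ℝ) * X j t) - ∑ t, (m t : ℝ) * X l t := by
    intro X
    simp only [n, Int.cast_sub, sub_mul, Finset.sum_sub_distrib, hrow]
  have hre : ∀ X : Config N,
      Real.cos ((2 * Real.pi / L * ∑ t, (m t : ℝ) * X j t) - (2 * Real.pi / L * ∑ t, (m t : ℝ) * X l t)) = (cellWaveN L n X).re := by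
    intro X
    rw [cellWaveN_apply]
    have h2 : (2 * Real.pi / L * ∑ t, (m t : ℝ) * X j t) - (2 * Real.pi / L * ∑ t, (m t : ℝ) * X l t) =
        2 * Real.pi * (∑ p : Fin N × Fin 3, (n p : ℝ) * X p.1 p.2) / L := by
      rw [hphase]; ring
    have h1 : Complex.exp (2 * Real.pi * Complex.I * (∑ p, (n p : ℝ) * X p.1 p.2) / L) =
        Complex.exp ((((2 * Real.pi / L * ∑ t, (m t : ℝ) * X j t) - (2 * Real.pi / L * ∑ t, (m t : ℝ) * X l t) : ℝ) : ℂ) * Complex.I) := by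
      congr 1
      rw [h2]
      push_cast
      ring
    rw [h1, Complex.exp_ofReal_mul_I_re]
  have hint0 : ∫ X in cellN N L, cellWaveN L n X = 0 := by
    have h1 := integral_fromUnitTorusN (N := N) hL (G := cellWaveN L n)
      (continuous_cellWaveN L n).aestronglyMeasurable
    have h3 : ∀ t : UnitAddTorus (Fin N × Fin 3),
        cellWaveN L n (fromUnitTorusN L t) = mFourier n t := by
      intro t; unfold cellWaveN; rw [toUnitTorusN_fromUnitTorusN hL.ne']
    simp_rw [h3] at h1
    -- `∫ e_n = 0` over the torus (`n ≠ 0`; orthonormality of the characters)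
    have h := orthonormal_iff_ite.1 (orthonormal_mFourier (d := Fin N × Fin 3)) 0 n
    rw [ContinuousMap.inner_toLp] at h
    simp only [mFourier_zero, ContinuousMap.one_apply, map_one, mul_one] at h
    rw [if_neg (Ne.symm hn0)] at h
    have h4 : ((((L ^ 3)⁻¹) ^ N : ℝ)) • ∫ X in cellN N L, cellWaveN L n X = 0 := h1.symm.trans h
    have hc : (((L ^ 3)⁻¹) ^ N : ℝ) ≠ 0 := by positivity
    exact (smul_eq_zero.1 h4).resolve_left hc
  have hVtop : volume (cellN N L) ≠ ⊤ := by
    rw [volume_cellN]; exact ENNReal.pow_ne_top (ENNReal.pow_ne_top ENNReal.ofReal_ne_top)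
  have hInt : Integrable (cellWaveN L n) (volume.restrict (cellN N L)) :=
    Measure.integrableOn_of_bounded (M := 1) hVtop (continuous_cellWaveN L n).aestronglyMeasurable
      (ae_of_all _ fun X => (norm_cellWaveN L n X).le)
  calc ∫ X in cellN N L, Real.cos ((2 * Real.pi / L * ∑ t, (m t : ℝ) * X j t) - (2 * Real.pi / L * ∑ t, (m t : ℝ) * X l t))
      = ∫ X in cellN N L, (cellWaveN L n X).re :=
        setIntegral_congr_fun (measurableSet_cellN N L) fun X _ => hre X
    _ = (∫ X in cellN N L, cellWaveN L n X).re := by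
        have h := integral_re hInt
        simpa only [RCLike.re_to_complex] using h
    _ = 0 := by rw [hint0, Complex.zero_re]

/-- **Uniform second moment of the density wave**: `∫_{cell^N} |ρ̂_m|² dX = N · |cell^N|` for every
lattice momentum `m ≠ 0` (diagonal `j = l` terms give `|cell^N|` each, off-diagonal ones vanish).
[folklore] -/
theorem lintegral_cellN_nnnorm_densityWave_sq {L : ℝ} (hL : 0 < L) {m : Fin 3 → ℤ} (hm : m ≠ 0) :
    ∫⁻ X in cellN N L, (‖densityWave N L m X‖₊ : ℝ≥0∞) ^ 2 = (N : ℝ≥0∞) * volume (cellN N L) := by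
  classical
  have hVtop : volume (cellN N L) ≠ ⊤ := by
    rw [volume_cellN]; exact ENNReal.pow_ne_top (ENNReal.pow_ne_top ENNReal.ofReal_ne_top)
  have hcos_int : ∀ j l : Fin N,
      Integrable (fun X : Config N => Real.cos ((2 * Real.pi / L * ∑ t, (m t : ℝ) * X j t) - (2 * Real.pi / L * ∑ t, (m t : ℝ) * X l t)))
        (volume.restrict (cellN N L)) := by
    intro j l
    refine Measure.integrableOn_of_bounded (M := 1) hVtop ?_ (ae_of_all _ fun X => ?_)
    · exact (Real.continuous_cos.comp
        ((continuous_phaseArg L m j).sub (continuous_phaseArg L m l))).aestronglyMeasurable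
    · rw [Real.norm_eq_abs]; exact Real.abs_cos_le_one _
  have hreal : ∫ X in cellN N L, ‖densityWave N L m X‖ ^ 2 = (N : ℝ) * (volume (cellN N L)).toReal := by
    simp_rw [norm_densityWave_sq_eq_sum_cos]
    rw [integral_finsetSum _ (fun j _ => integrable_finsetSum _ (fun l _ => hcos_int j l))]
    have hinner : ∀ j : Fin N,
        ∫ X in cellN N L, ∑ l, Real.cos ((2 * Real.pi / L * ∑ t, (m t : ℝ) * X j t) - (2 * Real.pi / L * ∑ t, (m t : ℝ) * X l t)) =
          (volume (cellN N L)).toReal := by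
      intro j
      rw [integral_finsetSum _ (fun l _ => hcos_int j l), Finset.sum_eq_single j]
      · simp only [sub_self, Real.cos_zero]
        rw [setIntegral_const, measureReal_def, smul_eq_mul, mul_one]
      · intro l _ hlj
        exact integral_cellN_cos_phaseArg_sub hL hm (Ne.symm hlj)
      · intro h; exact absurd (Finset.mem_univ j) h
    simp_rw [hinner]
    rw [Finset.sum_const, Finset.card_univ, Fintype.card_fin, nsmul_eq_mul]
  have hnn : 0 ≤ᵐ[volume.restrict (cellN N L)] fun X => ‖densityWave N L m X‖ ^ 2 :=
    ae_of_all _ fun X => by positivity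
  have hint : Integrable (fun X => ‖densityWave N L m X‖ ^ 2) (volume.restrict (cellN N L)) := by
    refine Measure.integrableOn_of_bounded (M := (N : ℝ) ^ 2) hVtop
      ((continuous_densityWave L m).norm.pow 2).aestronglyMeasurable (ae_of_all _ fun X => ?_)
    rw [Real.norm_of_nonneg (by positivity)]
    exact pow_le_pow_left₀ (norm_nonneg _) (norm_densityWave_le L m X) 2
  calc ∫⁻ X in cellN N L, (‖densityWave N L m X‖₊ : ℝ≥0∞) ^ 2
      = ∫⁻ X in cellN N L, ENNReal.ofReal (‖densityWave N L m X‖ ^ 2) := by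
        refine lintegral_congr fun X => ?_
        rw [ENNReal.ofReal_pow (norm_nonneg _), ofReal_norm, enorm_eq_nnnorm]
    _ = ENNReal.ofReal (∫ X in cellN N L, ‖densityWave N L m X‖ ^ 2) :=
        (ofReal_integral_eq_lintegral_ofReal hint hnn).symm
    _ = (N : ℝ≥0∞) * volume (cellN N L) := by
        rw [hreal, ENNReal.ofReal_mul (Nat.cast_nonneg _), ENNReal.ofReal_natCast,
          ENNReal.ofReal_toReal hVtop]

/-- **The free leaf holds**: for `scatteringLength v = 0` (`E₀^per = 0` by the LSSY upper bound),
every `δ_N = π²/(L_N² N²)`-near-minimiser is `N⁻¹`-close in `L²(cell^N)` to its mean (Neumann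
Poincaré gap of the cube), and `√(N S_N(k))` is `N`-Lipschitz in the state
(`lintegral_densityWave_sub_sq_rpow_le`); with the uniform second moment
`∫|ρ̂_k|² = N |cell^N|` and Minkowski this gives `N S_N(k) ≤ 9 N` for every `k ≠ 0`.
[cite: LSSY2005, Thm. 2.2 and after (2.50)] -/
theorem freeDensityFlatness_holds :
    ∀ v : ℝ → ENNReal, Literature.MathematicalPhysics.QuantumManyBody.BoseGas.IsRepulsiveFiniteRange v → Literature.MathematicalPhysics.QuantumManyBody.BoseGas.scatteringLength v = 0 → ∃ κ : ℝ, 0 < κ ∧ ∃ σ : ℝ, 0 < σ ∧ ∃ ρ₀ : ℝ, 0 < ρ₀ ∧ ∀ ρ : ℝ, 0 < ρ → ρ < ρ₀ → ∀ᶠ N : ℕ in Filter.atTop, ∃ δ : ENNReal, 0 < δ ∧ ∀ Ψ : Literature.MathematicalPhysics.QuantumManyBody.BoseGas.PeriodicTrialState N (Literature.MathematicalPhysics.QuantumManyBody.BoseGas.sideLength ρ N), Literature.MathematicalPhysics.QuantumManyBody.BoseGas.periodicEnergy v Ψ ≤ Literature.MathematicalPhysics.QuantumManyBody.BoseGas.periodicGroundStateEnergy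 v N (Literature.MathematicalPhysics.QuantumManyBody.BoseGas.sideLength ρ N) + δ → ∀ m : Fin 3 → ℤ, m ≠ 0 → (∀ j : Fin 3, |((m j : ℤ) : ℝ)| ≤ κ * Real.sqrt ρ * Literature.MathematicalPhysics.QuantumManyBody.BoseGas.sideLength ρ N) → Literature.MathematicalPhysics.QuantumManyBody.BoseGas.structureFactorVar N (Literature.MathematicalPhysics.QuantumManyBody.BoseGas.sideLength ρ N) ((Literature.MathematicalPhysics.QuantumManyBody.BoseGas.cellN N (Literature.MathematicalPhysics.QuantumManyBody.BoseGas.sideLength ρ N)).indicator Ψ.ψ) m ≤ ENNReal.ofReal σ * (N : ENNReal) := by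
  intro v hv ha
  obtain ⟨R₀, hE0⟩ : ∃ R₀ : ℝ, ∀ (N : ℕ) (L : ℝ), 2 ≤ N → 0 < L → 2 * R₀ < L →
      periodicGroundStateEnergy v N L = 0 := by
    obtain ⟨hmeas, R₀, hR⟩ := hv
    obtain ⟨C, c, _, hc, h⟩ :=
      LSSY2005_upperBound_periodic_holds v R₀ hmeas hR (by rw [ha]; exact ENNReal.zero_ne_top)
    refine ⟨R₀, fun N L hN hL hRL => ?_⟩
    have key := h N L hN hL hRL
    simp only [ha, ENNReal.toReal_zero, zero_div, mul_zero, zero_mul, ENNReal.ofReal_zero,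
      nonpos_iff_eq_zero] at key
    exact key hc.le
  refine ⟨1, one_pos, 9, by norm_num, 1, one_pos, fun ρ hρ _ => ?_⟩
  filter_upwards [eventually_ge_atTop 2, (tendsto_sideLength_atTop hρ).eventually_gt_atTop (2 * R₀)]
    with N hN2 hNR
  have hN0 : 0 < N := lt_of_lt_of_le (by norm_num) hN2
  have hNr : (0 : ℝ) < N := Nat.cast_pos.2 hN0
  set L := sideLength ρ N with hLdef
  have hL : 0 < L := by rw [hLdef]; unfold sideLength; exact Real.rpow_pos_of_pos (div_pos hNr hρ) _
  refine ⟨ENNReal.ofReal (Real.pi ^ 2 / L ^ 2 * ((N : ℝ)⁻¹) ^ 2),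
    ENNReal.ofReal_pos.2 (by positivity), fun Ψ hΨ m hm _ => ?_⟩
  -- Poincaré on the cube (Neumann gap) for the near-minimiser
  have hP := Poincare.poincare_boxN N L hL Ψ.ψ Ψ.contDiff
  rw [setLIntegral_congr (boxN_ae_eq_cellN N L), setLIntegral_congr (boxN_ae_eq_cellN N L)] at hP
  set c : ℂ := ⨍ Y in boxN N L, Ψ.ψ Y with hc
  set D : ℝ≥0∞ := ∫⁻ X in cellN N L, (‖Ψ.ψ X - c‖₊ : ℝ≥0∞) ^ 2 with hD
  set V : ℝ≥0∞ := volume (cellN N L) with hV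
  have hVtop : V ≠ ⊤ := by
    rw [hV, volume_cellN]; exact ENNReal.pow_ne_top (ENNReal.pow_ne_top ENNReal.ofReal_ne_top)
  -- (1) `D ≤ N⁻²`
  have hDle : D ≤ ((N : ℝ≥0∞)⁻¹) ^ 2 := by
    have hkin : ∫⁻ X in cellN N L, kineticDensity Ψ.ψ X ≤ periodicEnergy v Ψ :=
      lintegral_mono fun X => le_self_add
    have hE : periodicEnergy v Ψ ≤ ENNReal.ofReal (Real.pi ^ 2 / L ^ 2 * ((N : ℝ)⁻¹) ^ 2) := by
      have h := hΨ
      rwa [hE0 N L hN2 hL hNR, zero_add] at h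
    have h1 : ENNReal.ofReal (Real.pi ^ 2 / L ^ 2) * D ≤
        ENNReal.ofReal (Real.pi ^ 2 / L ^ 2) * ((N : ℝ≥0∞)⁻¹) ^ 2 := by
      calc ENNReal.ofReal (Real.pi ^ 2 / L ^ 2) * D ≤ periodicEnergy v Ψ := hP.trans hkin
        _ ≤ ENNReal.ofReal (Real.pi ^ 2 / L ^ 2 * ((N : ℝ)⁻¹) ^ 2) := hE
        _ = ENNReal.ofReal (Real.pi ^ 2 / L ^ 2) * ((N : ℝ≥0∞)⁻¹) ^ 2 := by
          rw [ENNReal.ofReal_mul (by positivity), ENNReal.ofReal_pow (by positivity),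
            ENNReal.ofReal_inv_of_pos hNr, ENNReal.ofReal_natCast]
    have hπ0 : ENNReal.ofReal (Real.pi ^ 2 / L ^ 2) ≠ 0 := by
      rw [← pos_iff_ne_zero, ENNReal.ofReal_pos]; positivity
    exact (ENNReal.mul_le_mul_iff_right hπ0 ENNReal.ofReal_ne_top).1 h1
  have hDsqrt : D ^ (1 / 2 : ℝ) ≤ (N : ℝ≥0∞)⁻¹ :=
    (ENNReal.rpow_le_rpow hDle (by norm_num)).trans_eq (by rw [← ENNReal.rpow_two, ← ENNReal.rpow_mul]; norm_num)
  -- (2) Minkowski: `‖c·1‖₂ ≤ ‖Ψ‖₂ + ‖Ψ − c‖₂ = 1 + √D ≤ 2`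
  have hcV : ((‖c‖₊ : ℝ≥0∞) ^ 2 * V) ^ (1 / 2 : ℝ) ≤ 2 := by
    have hΨm : Measurable fun X => (‖Ψ.ψ X‖₊ : ℝ≥0∞) :=
      Ψ.contDiff.continuous.measurable.nnnorm.coe_nnreal_ennreal
    have hΨcm : Measurable fun X => (‖Ψ.ψ X - c‖₊ : ℝ≥0∞) :=
      (Ψ.contDiff.continuous.sub continuous_const).measurable.nnnorm.coe_nnreal_ennreal
    have hM := ENNReal.lintegral_Lp_add_le (μ := volume.restrict (cellN N L))
      (f := fun X => (‖Ψ.ψ X‖₊ : ℝ≥0∞)) (g := fun X => (‖Ψ.ψ X - c‖₊ : ℝ≥0∞))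
      hΨm.aemeasurable hΨcm.aemeasurable (by norm_num : (1 : ℝ) ≤ 2)
    simp only [Pi.add_apply, ENNReal.rpow_two] at hM
    have hpt : ∀ X, ((‖c‖₊ : ℝ≥0∞)) ^ 2 ≤ ((‖Ψ.ψ X‖₊ : ℝ≥0∞) + ‖Ψ.ψ X - c‖₊) ^ 2 := fun X => by
      gcongr
      have h := nnnorm_add_le (Ψ.ψ X) (c - Ψ.ψ X)
      rw [add_sub_cancel, ← neg_sub, nnnorm_neg] at h
      exact_mod_cast h
    calc ((‖c‖₊ : ℝ≥0∞) ^ 2 * V) ^ (1 / 2 : ℝ)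
        = (∫⁻ _X in cellN N L, (‖c‖₊ : ℝ≥0∞) ^ 2) ^ (1 / 2 : ℝ) := by rw [setLIntegral_const]
      _ ≤ (∫⁻ X in cellN N L, ((‖Ψ.ψ X‖₊ : ℝ≥0∞) + ‖Ψ.ψ X - c‖₊) ^ 2) ^ (1 / 2 : ℝ) :=
        ENNReal.rpow_le_rpow (lintegral_mono hpt) (by norm_num)
      _ ≤ (∫⁻ X in cellN N L, (‖Ψ.ψ X‖₊ : ℝ≥0∞) ^ 2) ^ (1 / 2 : ℝ) +
            (∫⁻ X in cellN N L, (‖Ψ.ψ X - c‖₊ : ℝ≥0∞) ^ 2) ^ (1 / 2 : ℝ) := hM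
      _ = 1 + D ^ (1 / 2 : ℝ) := by rw [Ψ.norm_eq, ENNReal.one_rpow]
      _ ≤ 1 + (N : ℝ≥0∞)⁻¹ := by gcongr
      _ ≤ 1 + 1 := by
        gcongr
        exact ENNReal.inv_le_one.2 (Nat.one_le_cast.2 hN0)
      _ = 2 := one_add_one_eq_two
  -- (3) Lipschitz comparison of `Ψ·1_cell` with the constant state `c·1_cell`
  set Ψ' : Config N → ℂ := (cellN N L).indicator Ψ.ψ with hΨ'
  set Φ : Config N → ℂ := (cellN N L).indicator (fun _ => c) with hΦ
  have hΨ'm : AEMeasurable Ψ' :=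
    (Ψ.contDiff.continuous.measurable.indicator (measurableSet_cellN N L)).aemeasurable
  have hΦm : AEMeasurable Φ := (measurable_const.indicator (measurableSet_cellN N L)).aemeasurable
  have hLip := lintegral_densityWave_sub_sq_rpow_le L m hΨ'm hΦm 0
  simp only [sub_zero, nnnorm_zero, ENNReal.coe_zero, add_zero] at hLip
  have hU : ∫⁻ X in cellN N L, (‖densityWave N L m X‖₊ : ℝ≥0∞) ^ 2 = (N : ℝ≥0∞) * V :=
    lintegral_cellN_nnnorm_densityWave_sq hL hm
  have hT1 : ∫⁻ X, (‖densityWave N L m X‖₊ : ℝ≥0∞) ^ 2 * (‖Φ X‖₊ : ℝ≥0∞) ^ 2 =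
      (N : ℝ≥0∞) * ((‖c‖₊ : ℝ≥0∞) ^ 2 * V) := by
    have h : (fun X => (‖densityWave N L m X‖₊ : ℝ≥0∞) ^ 2 * (‖Φ X‖₊ : ℝ≥0∞) ^ 2) =
        (cellN N L).indicator (fun X => (‖densityWave N L m X‖₊ : ℝ≥0∞) ^ 2 * (‖c‖₊ : ℝ≥0∞) ^ 2) := by
      funext X
      by_cases hX : X ∈ cellN N L <;> simp [hΦ, hX]
    rw [h, lintegral_indicator (measurableSet_cellN N L),
      lintegral_mul_const _ ((measurable_densityWave L m).nnnorm.coe_nnreal_ennreal.pow_const 2), hU]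
    ring
  have hT2 : ∫⁻ X, (‖Ψ' X - Φ X‖₊ : ℝ≥0∞) ^ 2 = D := by
    have h : (fun X => (‖Ψ' X - Φ X‖₊ : ℝ≥0∞) ^ 2) =
        (cellN N L).indicator (fun X => (‖Ψ.ψ X - c‖₊ : ℝ≥0∞) ^ 2) := by
      funext X
      by_cases hX : X ∈ cellN N L <;> simp [hΨ', hΦ, hX]
    rw [h, lintegral_indicator (measurableSet_cellN N L)]
  have hS : structureFactorVar N L Ψ' m ≤
      ∫⁻ X, (‖densityWave N L m X‖₊ : ℝ≥0∞) ^ 2 * (‖Ψ' X‖₊ : ℝ≥0∞) ^ 2 := by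
    simpa using structureFactorVar_le_lintegral L Ψ' m 0
  rw [hT1, hT2] at hLip
  -- (4) arithmetic: `√S ≤ √N·2 + N·N⁻¹ ≤ 3√N`, so `S ≤ 9N`
  have hNne : (N : ℝ≥0∞) ≠ 0 := Nat.cast_ne_zero.2 hN0.ne'
  have hone : (1 : ℝ≥0∞) ≤ (N : ℝ≥0∞) ^ (1 / 2 : ℝ) :=
    ENNReal.one_le_rpow (Nat.one_le_cast.2 hN0) (by norm_num)
  have hsqrt : (structureFactorVar N L Ψ' m) ^ (1 / 2 : ℝ) ≤ 3 * (N : ℝ≥0∞) ^ (1 / 2 : ℝ) := by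
    calc (structureFactorVar N L Ψ' m) ^ (1 / 2 : ℝ)
        ≤ (∫⁻ X, (‖densityWave N L m X‖₊ : ℝ≥0∞) ^ 2 * (‖Ψ' X‖₊ : ℝ≥0∞) ^ 2) ^ (1 / 2 : ℝ) :=
          ENNReal.rpow_le_rpow hS (by norm_num)
      _ ≤ ((N : ℝ≥0∞) * ((‖c‖₊ : ℝ≥0∞) ^ 2 * V)) ^ (1 / 2 : ℝ) + (N : ℝ≥0∞) * D ^ (1 / 2 : ℝ) := hLip
      _ = (N : ℝ≥0∞) ^ (1 / 2 : ℝ) * ((‖c‖₊ : ℝ≥0∞) ^ 2 * V) ^ (1 / 2 : ℝ) +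
            (N : ℝ≥0∞) * D ^ (1 / 2 : ℝ) := by
          rw [ENNReal.mul_rpow_of_nonneg _ _ (by norm_num : (0 : ℝ) ≤ 1 / 2)]
      _ ≤ (N : ℝ≥0∞) ^ (1 / 2 : ℝ) * 2 + (N : ℝ≥0∞) * (N : ℝ≥0∞)⁻¹ := by gcongr
      _ = (N : ℝ≥0∞) ^ (1 / 2 : ℝ) * 2 + 1 := by
          rw [ENNReal.mul_inv_cancel hNne (ENNReal.natCast_ne_top N)]
      _ ≤ (N : ℝ≥0∞) ^ (1 / 2 : ℝ) * 2 + (N : ℝ≥0∞) ^ (1 / 2 : ℝ) := by gcongr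
      _ = 3 * (N : ℝ≥0∞) ^ (1 / 2 : ℝ) := by ring
  have hfin := ENNReal.rpow_le_rpow hsqrt (z := 2) (by norm_num)
  rw [← ENNReal.rpow_mul, show (1 / 2 : ℝ) * 2 = 1 by norm_num, ENNReal.rpow_one,
    ENNReal.mul_rpow_of_nonneg _ _ (by norm_num : (0 : ℝ) ≤ 2), ← ENNReal.rpow_mul,
    show (1 / 2 : ℝ) * 2 = 1 by norm_num, ENNReal.rpow_one, ENNReal.rpow_two] at hfin
  calc structureFactorVar N L Ψ' m ≤ 3 ^ 2 * (N : ℝ≥0∞) := hfin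
    _ = ENNReal.ofReal 9 * (N : ℝ≥0∞) := by norm_num

end FreeGas

end Summit.AtomisticToContinuum.BoseEinsteinCondensation.Theorems.DeepInfraredEmptinessFreeFlatness
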